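import Summits.ValiantsHypothesis.ValiantsHypothesis.Theses.SliceSignRank

/-!
# Birth skeleton — crux `SignRankSuperQP` (item `stmt-ValiantsHypothesis-15118`), line `birth`

Route `route-ValiantsHypothesis-SliceSignRank`, crux
`Summit.ValiantsHypothesis.ValiantsHypothesis.Theses.SliceSignRank.SignRankSuperQP` (SRK: the
sign-rank with don't-cares of the Levi-Civita tensor, `srk(n)` = least `k` such that `k` real twists
`W_1 … W_k` make `sgn σ · Σ_t Π_i W_t(σ(i), i) > 0` for every `σ ∈ S_n`, is not quasi-polynomially
bounded).

## The line: FORSTER TRANSFER (spectral side of the sign-rank dictionary the crux imports)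

Forster's theorem [Forster2002]: an `N × N` sign matrix `M` of sign-rank `k` has a rank-one matrix
`u vᵀ` with normalised correlation `⟨M, u vᵀ⟩ / (‖M‖_F ‖u vᵀ‖_F) ≥ 1/k` (equivalently
`k ≥ N/‖M‖`).  In the permutation-slice model of this route the rank-one matrices are replaced by
the MONOMIAL FUNCTIONS `f_V(σ) := Π_i V(σ(i), i)` of a single real twist `V` (rank-one tensors read on
the permutation support), and for these

* `⟨sgn, f_V⟩ = Σ_σ sgn σ Π_i V(σ i, i) = det V` (Leibniz),
* `‖f_V‖² = Σ_σ Π_i V(σ i, i)² = per (V ∘ V)` (permanent of the Hadamard square),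
* `‖sgn‖² = n!`.

So the slice analogue of Forster's inequality reads: a `k`-term sign-representation of `sgn` on `S_n`
forces ONE twist `V` with `det V ≠ 0` and `n! · per(V∘V) ≤ k^C · det(V)²` (`C = 2` is Forster's
exponent; any polynomial loss `C` is allowed) — stub A, the bet.  The complementary analytic input is a
THEOREM (stub B, provable now from facts already in the tree): `n! · det(V)² ≤ nⁿ · per(V∘V)` for
every real `V`, i.e. the normalised correlation of `sgn` with ANY monomial function is at most
`√(nⁿ/n!)/√(n!) ≈ (e/√n)ⁿ`.  It is Gurvits' capacity bound (the van der Waerden / Egorychev–Falikman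
inequality, `Literature.Combinatorics.StablePolynomials.Gurvits.factorial_mul_le_pow_mul_coeff_one`,
`Literature.Combinatorics.Enumerative.VanDerWaerdenPermanent_holds`) for the real stable polynomial
`p(z) = Π_i Σ_j V_ij² z_j`, whose mixed coefficient is `per(V∘V)`
(`Literature.Combinatorics.Enumerative.coeff_prod_rowForms_eq_permanent`) and whose capacity is
`≥ det(V)²` by Hadamard's inequality `det(M)² ≤ Π_i Σ_j M_ij²`
(`Literature.Barriers.MatrixMultiplication.det_sq_le_prod_sum_sq`) applied to `M = V · diag(√z)`.
Together: `(n!)² ≤ nⁿ · k^C` for every `k`-term representation, i.e. `srk(n) ≥ ((n!)²/nⁿ)^{1/C}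
= 2^{Ω(n log n)}`, and the composition below is the arithmetic `nⁿ · (2^{(log₂ n + c)^c})^C < (n!)²`
for large `n` (`n! ≥ nⁿ/eⁿ`, `e² < 8`, polylog versus `2^L`).

Answer to the card's objection ("spectral/discrepancy (Forster-type) arguments fail because
log-linear weights can zoom onto one permutation, `sup_M |det M| / per|M| = 1`"): that supremum is the
`L¹`-normalised correlation (discrepancy), which indeed is useless; Forster's inequality is the
`L²`-normalised one, and zooming onto one permutation (`V = 1`) gives `L²`-correlation `1/√(n!)`, far
BELOW the `k^{-C/2}` the bet asks for — stub B says no twist does better than `(e/√n)ⁿ`.  What does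
NOT transfer from Forster's proof is the `GL_k`-isotropic-position step (the slice model only has the
positive torus `f ↦ Λ·f`, `Λ(σ) = Π_i λ_{σ(i),i}`, acting on representations); that is the content of
stub A.

Stubs (registered obligations; the ONLY sorries of this file):

* `stub_forsterSlice` (A — the bet; conjecture-grade, XL): Forster's inequality for the permutation
  slice up to polynomial loss.  Why it might fail: a `2^{o(n log n)}`-term mixed-signing construction
  (none is known; the sinh-product constructions of the card have `2^{q(n)}`, `q(n) ≥ c·n` terms, and
  nothing below `2^{O(n²)}` is proved in general); equivalently `srk(n) = 2^{o(n log n)}`.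
  Consistency checks: `n = 2, k = 1` is TIGHT (`V = W = [[1,−1],[1,1]]`: `2 · 2 = 1 · 4`);
  `n = 3, 4, 5` with `srk = 2, 2, 4` (card data) hold with `C = 2` and `V` a (near-)Hadamard twist
  (`det²/per(V∘V) = 729/177, 256/24, 2304/120 ≥ n!/k² = 1.5, 6, 7.5`).
* `stub_vdwHadamard` (B — provable now, M): `n! · det(V)² ≤ nⁿ · per(V∘V)`; sharp at flat orthogonal
  (Hadamard) `V`.  Proof route above (Gurvits + Hadamard, both in the tree; no Sinkhorn scaling needed).
* `SignRankSuperQP_of : Stmt.stub_forsterSlice → Stmt.stub_vdwHadamard → SignRankSuperQP` — PROVED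
  here (sorry-free): `factorial_sq_le_of_signRep` (A + B ⇒ `(n!)² ≤ nⁿ k^C`) and the asymptotics
  `eventually_qp_lt_factorial_sq` (`nⁿ k^C < (n!)²` for `k ≤ 2^{(log₂ n + c)^c}`, `n ≥ n₀(c, C)`).

Disproof used: none exists (`ledger crux ls stmt-ValiantsHypothesis-15118`: no workfiles at
registration, no `_false_without_` theorem, nothing under `Theorems/SignRankSuperQP/Negative/`).
Negatives index (`ledger negatives --problem ValiantsHypothesis`): nothing on sign-representations,
permanents of Hadamard squares or Forster-type inequalities.  `k = 0` is harmless everywhere (empty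
sum, `0 < 0` false), `n = 0, 1` are checked in the docstrings below.
-/

set_option linter.dupNamespace false

namespace Summit.ValiantsHypothesis.ValiantsHypothesis.Cruxes.SignRankSuperQP.Birth

open Summit.ValiantsHypothesis.ValiantsHypothesis.Theses.SliceSignRank

/-! ## §0 The two stub statements -/

/-- **A — FORSTER'S INEQUALITY FOR THE PERMUTATION SLICE** (stub statement, named; the bet).
There is an exponent `C` such that whenever `k` real twists sign-represent `sgn` on `S_n`
(`0 < sgn σ · Σ_t Π_i W_t(σ i, i)` for all `σ`), some single real twist `V` has `det V ≠ 0` and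
`n! · per(V ∘ V) ≤ k^C · det(V)²` — the `L²`-normalised correlation of `sgn` with the monomial
function `σ ↦ Π_i V(σ i, i)` is at least `k^{-C/2}` (`C = 2`: Forster's exponent).  Degenerate
cases: `k = 0` never represents (empty sum); `n = 0`: `V = ()`, `1 · 1 ≤ k^C · 1`; `n = 1`:
`V = (v)`, `v² ≤ k^C v²`; `n = 2, k = 1`: equality at `V = [[1,−1],[1,1]]`.
[conjecture-grade analogue of Forster2002 (JCSS 65, Thm 2.2); RazborovSherstov2010 §1] -/
def Stmt.stub_forsterSlice : Prop :=
  ∃ C : ℕ, ∀ (n k : ℕ) (W : Fin k → Matrix (Fin n) (Fin n) ℝ),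
    (∀ σ : Equiv.Perm (Fin n), 0 < ((Equiv.Perm.sign σ : ℤ) : ℝ) * ∑ t, ∏ i, W t (σ i) i) →
    ∃ V : Matrix (Fin n) (Fin n) ℝ, V.det ≠ 0 ∧
      (n.factorial : ℝ) * (Matrix.of fun i j => V i j ^ 2).permanent ≤ (k : ℝ) ^ C * V.det ^ 2

/-- **B — VAN DER WAERDEN–HADAMARD BOUND FOR TWISTED CORRELATIONS** (stub statement, named;
provable now): for every real square matrix `V`, `n! · det(V)² ≤ nⁿ · per(V ∘ V)` where `V ∘ V` is the
entrywise square.  (= Gurvits' capacity bound for `Π_i Σ_j V_ij² z_j`, capacity `≥ det(V)²` by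
Hadamard; sharp at Hadamard matrices; `n = 0`: `1 ≤ 1`; `n = 2`: `(ad−bc)² ≤ 2(a²d²+b²c²)`.)
[Egorychev1981 Thm 1 / Falikman1981 / Gurvits2008 §2 + Hadamard's inequality; in tree:
`Gurvits.factorial_mul_le_pow_mul_coeff_one`, `coeff_prod_rowForms_eq_permanent`,
`det_sq_le_prod_sum_sq`] -/
def Stmt.stub_vdwHadamard : Prop :=
  ∀ (n : ℕ) (V : Matrix (Fin n) (Fin n) ℝ),
    (n.factorial : ℝ) * V.det ^ 2 ≤ (n : ℝ) ^ n * (Matrix.of fun i j => V i j ^ 2).permanent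

/-! ## §1 The two registered stubs (the ONLY sorries of this file) -/

/-- Registered stub A = `Stmt.stub_forsterSlice` verbatim (Forster's inequality for the slice, up to
polynomial loss). [conjecture-grade: Forster2002, RazborovSherstov2010] -/
theorem stub_forsterSlice :
    ∃ C : ℕ, ∀ (n k : ℕ) (W : Fin k → Matrix (Fin n) (Fin n) ℝ),
      (∀ σ : Equiv.Perm (Fin n), 0 < ((Equiv.Perm.sign σ : ℤ) : ℝ) * ∑ t, ∏ i, W t (σ i) i) →
      ∃ V : Matrix (Fin n) (Fin n) ℝ, V.det ≠ 0 ∧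
        (n.factorial : ℝ) * (Matrix.of fun i j => V i j ^ 2).permanent ≤
          (k : ℝ) ^ C * V.det ^ 2 := by
  sorry

/-- Registered stub B = `Stmt.stub_vdwHadamard` verbatim (van der Waerden–Hadamard).
[Egorychev1981, Falikman1981, Gurvits2008; provable now] -/
theorem stub_vdwHadamard :
    ∀ (n : ℕ) (V : Matrix (Fin n) (Fin n) ℝ),
      (n.factorial : ℝ) * V.det ^ 2 ≤
        (n : ℝ) ^ n * (Matrix.of fun i j => V i j ^ 2).permanent := by
  sorry

/-! ## §2 Glue lemmas (sorry-free) -/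

/-- **A + B ⇒ the counting inequality**: if `k` real twists sign-represent `sgn` on `S_n`, then
`(n!)² ≤ nⁿ · k^C` (`C` the exponent of stub A).  Multiply A (`n!·per ≤ k^C det²`) and B
(`n!·det² ≤ nⁿ per`) and cancel `det² > 0`.  Tight at `n = 2, k = 1`. [this skeleton] -/
theorem factorial_sq_le_of_signRep (C n k : ℕ) (W : Fin k → Matrix (Fin n) (Fin n) ℝ)
    (hW : ∀ σ : Equiv.Perm (Fin n), 0 < ((Equiv.Perm.sign σ : ℤ) : ℝ) * ∑ t, ∏ i, W t (σ i) i)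
    (hA : ∀ (n k : ℕ) (W : Fin k → Matrix (Fin n) (Fin n) ℝ),
      (∀ σ : Equiv.Perm (Fin n), 0 < ((Equiv.Perm.sign σ : ℤ) : ℝ) * ∑ t, ∏ i, W t (σ i) i) →
      ∃ V : Matrix (Fin n) (Fin n) ℝ, V.det ≠ 0 ∧
        (n.factorial : ℝ) * (Matrix.of fun i j => V i j ^ 2).permanent ≤ (k : ℝ) ^ C * V.det ^ 2)
    (hB : Stmt.stub_vdwHadamard) :
    (n.factorial : ℝ) ^ 2 ≤ (n : ℝ) ^ n * (k : ℝ) ^ C := by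
  obtain ⟨V, hdet, h1⟩ := hA n k W hW
  have h2 := hB n V
  set P : ℝ := (Matrix.of fun i j => V i j ^ 2).permanent with hP
  have hd : 0 < V.det ^ 2 := by positivity
  have hf : (0 : ℝ) ≤ n.factorial := Nat.cast_nonneg _
  have hn : (0 : ℝ) ≤ (n : ℝ) ^ n := by positivity
  -- n! · (n! det²) ≤ n! · (nⁿ P) = nⁿ · (n! P) ≤ nⁿ · (k^C det²)
  have h3 : (n.factorial : ℝ) * ((n.factorial : ℝ) * V.det ^ 2) ≤
      (n.factorial : ℝ) * ((n : ℝ) ^ n * P) := mul_le_mul_of_nonneg_left h2 hf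
  have h4 : (n : ℝ) ^ n * ((n.factorial : ℝ) * P) ≤ (n : ℝ) ^ n * ((k : ℝ) ^ C * V.det ^ 2) :=
    mul_le_mul_of_nonneg_left h1 hn
  have h5 : (n.factorial : ℝ) ^ 2 * V.det ^ 2 ≤ (n : ℝ) ^ n * (k : ℝ) ^ C * V.det ^ 2 :=
    calc (n.factorial : ℝ) ^ 2 * V.det ^ 2
        = (n.factorial : ℝ) * ((n.factorial : ℝ) * V.det ^ 2) := by ring
      _ ≤ (n.factorial : ℝ) * ((n : ℝ) ^ n * P) := h3
      _ = (n : ℝ) ^ n * ((n.factorial : ℝ) * P) := by ring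
      _ ≤ (n : ℝ) ^ n * ((k : ℝ) ^ C * V.det ^ 2) := h4
      _ = (n : ℝ) ^ n * (k : ℝ) ^ C * V.det ^ 2 := by ring
  exact le_of_mul_le_mul_right h5 hd

/-- Polynomial versus exponential: `(L + c)^c · C ≤ 2^L` for all large `L`. [folklore] -/
theorem poly_le_two_pow_eventually (c C : ℕ) :
    ∃ L₀ : ℕ, ∀ L : ℕ, L₀ ≤ L → (L + c) ^ c * C ≤ 2 ^ L := by
  have ht := tendsto_pow_const_div_const_pow_of_one_lt c (one_lt_two : (1 : ℝ) < 2)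
  set ε : ℝ := ((2 : ℝ) ^ c * ((C : ℝ) + 1))⁻¹ with hε_def
  have hD : (0 : ℝ) < (2 : ℝ) ^ c * ((C : ℝ) + 1) := by positivity
  have hε : (0 : ℝ) < ε := inv_pos.mpr hD
  obtain ⟨L₁, hL₁⟩ := Filter.eventually_atTop.mp (ht.eventually_lt_const hε)
  refine ⟨max L₁ c, fun L hL => ?_⟩
  have hL1 : L₁ ≤ L := le_of_max_le_left hL
  have hLc : c ≤ L := le_of_max_le_right hL
  have h2L : (0 : ℝ) < (2 : ℝ) ^ L := by positivity
  have h : (L : ℝ) ^ c / 2 ^ L < ε := hL₁ L hL1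
  rw [div_lt_iff₀ h2L] at h
  -- (L:ℝ)^c · (2^c (C+1)) < ε · 2^L · (2^c (C+1)) = 2^L
  have h' : (L : ℝ) ^ c * ((2 : ℝ) ^ c * ((C : ℝ) + 1)) < (2 : ℝ) ^ L := by
    have := mul_lt_mul_of_pos_right h hD
    calc (L : ℝ) ^ c * ((2 : ℝ) ^ c * ((C : ℝ) + 1))
        < ε * 2 ^ L * ((2 : ℝ) ^ c * ((C : ℝ) + 1)) := this
      _ = (ε * ((2 : ℝ) ^ c * ((C : ℝ) + 1))) * 2 ^ L := by ring
      _ = 2 ^ L := by rw [hε_def, inv_mul_cancel₀ hD.ne', one_mul]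
  have hnat : (((L + c) ^ c * C : ℕ) : ℝ) < ((2 ^ L : ℕ) : ℝ) := by
    push_cast
    have hLc' : (c : ℝ) ≤ L := by exact_mod_cast hLc
    calc ((L : ℝ) + c) ^ c * C ≤ ((L : ℝ) + L) ^ c * C := by gcongr
      _ = (L : ℝ) ^ c * ((2 : ℝ) ^ c * (C : ℝ)) := by ring
      _ ≤ (L : ℝ) ^ c * ((2 : ℝ) ^ c * ((C : ℝ) + 1)) := by gcongr; linarith
      _ < (2 : ℝ) ^ L := h'
  exact (by exact_mod_cast hnat : (L + c) ^ c * C < 2 ^ L).le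

/-- The analytic input of the composition: `(nⁿ)² < 8ⁿ · (n!)²` for `n ≥ 1`
(`n! ≥ nⁿ/eⁿ` from the exponential series, and `e² < 8`). [folklore] -/
theorem pow_self_sq_lt (n : ℕ) (hn : n ≠ 0) :
    ((n : ℝ) ^ n) ^ 2 < (n.factorial : ℝ) ^ 2 * 8 ^ n := by
  have hfac : (0 : ℝ) < n.factorial := by exact_mod_cast Nat.factorial_pos n
  have hE : (n : ℝ) ^ n ≤ Real.exp n * n.factorial := by
    have h := Real.pow_div_factorial_le_exp (x := (n : ℝ)) (Nat.cast_nonneg n) n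
    rwa [div_le_iff₀ hfac] at h
  have he8 : Real.exp (n : ℝ) ^ 2 < 8 ^ n := by
    have h1 : Real.exp 1 ^ 2 < 8 := by
      have := Real.exp_one_lt_d9
      have h0 : 0 < Real.exp 1 := Real.exp_pos 1
      nlinarith
    have h2 : Real.exp (n : ℝ) ^ 2 = (Real.exp 1 ^ 2) ^ n := by
      rw [← Real.exp_one_pow n]; ring
    rw [h2]
    exact pow_lt_pow_left₀ h1 (by positivity) hn
  have h0 : (0 : ℝ) ≤ (n : ℝ) ^ n := by positivity
  calc ((n : ℝ) ^ n) ^ 2 ≤ (Real.exp n * n.factorial) ^ 2 := by gcongr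
    _ = (n.factorial : ℝ) ^ 2 * Real.exp (n : ℝ) ^ 2 := by ring
    _ < (n.factorial : ℝ) ^ 2 * 8 ^ n := by gcongr

/-- **The asymptotics of the composition**: for every `c, C` there is `n₀` such that
`nⁿ · k^C < (n!)²` whenever `n ≥ n₀` and `k ≤ 2^{(log₂ n + c)^c}` (quasi-polynomial times `nⁿ` loses
to `(n!)² ≥ n^{2n}/e^{2n}`).  With `L = log₂ n ≥ 4`: `k^C ≤ 2^{C (L+c)^c} ≤ 2^{2^L·…}`, precisely
`C(L+c)^c ≤ 2^L ≤ n` (`poly_le_two_pow_eventually`), so `2^{C(L+c)^c} · 8ⁿ · nⁿ ≤ 2^{Ln} nⁿ ≤ n^{2n}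
< 8ⁿ (n!)²`. [folklore] -/
theorem eventually_qp_lt_factorial_sq (c C : ℕ) :
    ∃ n₀ : ℕ, ∀ n : ℕ, n₀ ≤ n → ∀ k : ℕ, k ≤ 2 ^ ((Nat.log 2 n + c) ^ c) →
      (n : ℝ) ^ n * (k : ℝ) ^ C < (n.factorial : ℝ) ^ 2 := by
  obtain ⟨L₀, hL₀⟩ := poly_le_two_pow_eventually c C
  refine ⟨2 ^ max L₀ 4, fun n hn k hk => ?_⟩
  have hpos : 0 < 2 ^ max L₀ 4 := pow_pos two_pos _
  have hn0 : n ≠ 0 := by omega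
  set L := Nat.log 2 n with hL
  have hLge : max L₀ 4 ≤ L := Nat.le_log_of_pow_le one_lt_two hn
  have hL4 : 4 ≤ L := le_of_max_le_right hLge
  have hLL₀ : L₀ ≤ L := le_of_max_le_left hLge
  have h2L : 2 ^ L ≤ n := Nat.pow_log_le_self 2 hn0
  have hA : (L + c) ^ c * C ≤ 2 ^ L := hL₀ L hLL₀
  -- k^C ≤ 2^A with A := (L + c)^c · C
  have hkC : k ^ C ≤ 2 ^ ((L + c) ^ c * C) :=
    calc k ^ C ≤ (2 ^ ((L + c) ^ c)) ^ C := Nat.pow_le_pow_left hk C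
      _ = 2 ^ ((L + c) ^ c * C) := (pow_mul 2 _ _).symm
  -- exponent bookkeeping: A + 3n ≤ L·n
  have hexp : (L + c) ^ c * C + 3 * n ≤ L * n := by
    have h1 : (L + c) ^ c * C ≤ n := hA.trans h2L
    nlinarith [hL4, h1]
  -- the ℕ chain: k^C · 8ⁿ · nⁿ ≤ 2^A · 8ⁿ · nⁿ = 2^{A+3n} nⁿ ≤ 2^{Ln} nⁿ ≤ nⁿ · nⁿ
  have hchain : k ^ C * 8 ^ n * n ^ n ≤ n ^ n * n ^ n :=
    calc k ^ C * 8 ^ n * n ^ n ≤ 2 ^ ((L + c) ^ c * C) * 8 ^ n * n ^ n := by gcongr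
      _ = 2 ^ ((L + c) ^ c * C + 3 * n) * n ^ n := by
          have h8 : (8 : ℕ) ^ n = 2 ^ (3 * n) := by rw [pow_mul]; norm_num
          rw [h8, pow_add]
      _ ≤ 2 ^ (L * n) * n ^ n :=
          Nat.mul_le_mul_right _ (Nat.pow_le_pow_right two_pos hexp)
      _ = (2 ^ L) ^ n * n ^ n := by rw [pow_mul]
      _ ≤ n ^ n * n ^ n := Nat.mul_le_mul_right _ (Nat.pow_le_pow_left h2L n)
  have hcast : (n : ℝ) ^ n * (k : ℝ) ^ C * 8 ^ n ≤ ((n : ℝ) ^ n) ^ 2 := by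
    have h1 : ((k ^ C * 8 ^ n * n ^ n : ℕ) : ℝ) ≤ ((n ^ n * n ^ n : ℕ) : ℝ) := by
      exact_mod_cast hchain
    push_cast at h1
    calc (n : ℝ) ^ n * (k : ℝ) ^ C * 8 ^ n = (k : ℝ) ^ C * 8 ^ n * (n : ℝ) ^ n := by ring
      _ ≤ (n : ℝ) ^ n * (n : ℝ) ^ n := h1
      _ = ((n : ℝ) ^ n) ^ 2 := by ring
  have hR : ((n : ℝ) ^ n) ^ 2 < (n.factorial : ℝ) ^ 2 * 8 ^ n := pow_self_sq_lt n hn0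
  have h8 : (0 : ℝ) < 8 ^ n := by positivity
  have hlt : (n : ℝ) ^ n * (k : ℝ) ^ C * 8 ^ n < (n.factorial : ℝ) ^ 2 * 8 ^ n :=
    lt_of_le_of_lt hcast hR
  exact lt_of_mul_lt_mul_right hlt h8.le

/-! ## §3 The composition (kernel-checked, no `sorry`) -/

/-- **The crux from the two stubs** (composition; conclusion literally the route decl
`SliceSignRank.SignRankSuperQP`).  Given `c`, take the exponent `C` of stub A and
`n₀ = n₀(c, C)` from `eventually_qp_lt_factorial_sq`; for `n ≥ n₀` and `k ≤ 2^{(log₂ n + c)^c}` a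
`k`-term sign-representation `W` would give `(n!)² ≤ nⁿ k^C` (`factorial_sq_le_of_signRep`, A + B)
against `nⁿ k^C < (n!)²`. -/
theorem SignRankSuperQP_of :
    Stmt.stub_forsterSlice → Stmt.stub_vdwHadamard →
      Summit.ValiantsHypothesis.ValiantsHypothesis.Theses.SliceSignRank.SignRankSuperQP := by
  rintro ⟨C, hA⟩ hB c
  obtain ⟨n₀, hn₀⟩ := eventually_qp_lt_factorial_sq c C
  refine ⟨n₀, fun n hn k hk hrep => ?_⟩
  obtain ⟨W, hW⟩ := hrep
  exact absurd (factorial_sq_le_of_signRep C n k W hW hA hB) (not_le.mpr (hn₀ n hn k hk))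

/-- Wiring check: the registered stubs feed `SignRankSuperQP_of` exactly as stated (the compiler checks
that the `Stmt` copies and the stub statements agree verbatim), so the skeleton is `SignRankSuperQP`
closed modulo the two stubs — sorries enter only through them. -/
example : Summit.ValiantsHypothesis.ValiantsHypothesis.Theses.SliceSignRank.SignRankSuperQP :=
  SignRankSuperQP_of stub_forsterSlice stub_vdwHadamard

end Summit.ValiantsHypothesis.ValiantsHypothesis.Cruxes.SignRankSuperQP.Birth
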